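import Literature.MathematicalPhysics.QuantumLattice.DWaveOrderParameterSemicontinuity
import Literature.MathematicalPhysics.QuantumLattice.HubbardHoppingBondNormSharp
import Literature.MathematicalPhysics.QuantumLattice.HubbardTTPrimeMeanEnergySupergradient
import HarnessLib

/-!
# Transport of the sourced energy density `e_src(t', U, μ, h)` along the next-nearest-neighbour hopping
# `t'`: the a-priori diagonal-hopping row `|K₂(ω)| ≤ 4`, the tangent at a minimiser, the `4`-Lipschitz law,
# and ABSENT box cells in all three couplings `(t', U, μ)`

Topic `Literature/MathematicalPhysics/QuantumLattice` (namespace = path; family `hubbard`). Sequel of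
`DWaveSourceEnergyDensityCouplingTransport.lean` (hubbard-cq-obsth-2: the `μ`- and `U`-directions) and of
`DWaveOrderParameterSemicontinuity.lean` (hubbard-cq-p5: ORDER IS CLOSED / ABSENCE IS OPEN; ABSENT box cells
in `(U, μ)`), supplying the one coupling axis those files leave qualitative — the next-nearest-neighbour
hopping `t'` of the `d`-wave pair-sourced `t–t'` Hubbard model
(`e_src(t',U,μ,h) = dWaveSourceEnergyDensityTT' t' U μ h`, `m⋆(t',U,μ) = dWaveOrderParameterTT' t' U μ`).
Written for the Hubbard cuprate cell (`hubbard-cq`: the two anchors `t' = 0` and `t' = −1/4` and the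
downfolded `t'`-boxes of the material-oracle phase map). Everything is PROVED; no definition, no named fact,
zero compute.

## Contents

* §1 THE A-PRIORI ROW. `meanEnergyObs_hubbardTTPrime_zero_one_zero`: the mean-energy observable of the unit
  diagonal-hopping interaction `Φ(0,1,0)` is that of `diagHoppingFermionInteraction 1`;
  `norm_meanEnergyObs_diagHopping_le_four_mul`: `‖E_{Φ_diag(t')}‖ ≤ 4|t'|` (two full diagonal bonds per
  site, each of norm `≤ 2|t'|`, `norm_fermionEmbed_diagHopping_pair_le_two_mul`); hence
  **`InfVolFermionState.abs_meanEnergy_diagHop_le_four`: `|K₂(ω)| ≤ 4` for EVERY infinite-volume state**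
  (`K₂(ω) = e_{Φ(0,1,0)}(ω)` the unit diagonal-hopping energy per site; states are contractive) — no
  translation invariance, no density hypothesis (the tree's `16/π²` and `4n` rows need a density in `(0,2)`).
* §2 THE TANGENT AND THE LIPSCHITZ LAW. `dWaveSourceEnergyDensityTT'_le_add_mul_diagHop_of_minimiser`:
  if the translation-invariant state `ω` attains `e_src` at `(t',U,μ,h)` then
  `e_src(t'',U,μ,h) ≤ e_src(t',U,μ,h) + (t'' − t')·K₂(ω)` for every `t''` (affinity of the mean energy in
  `t'`, `meanEnergy_hubbardTTPrime_affine`, and the variational principle at `t''`); with §1: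
  `dWaveSourceEnergyDensityTT'_le_add_four_mul_abs_sub_tp` and
  **`abs_dWaveSourceEnergyDensityTT'_sub_tp_le`: `|e_src(t',U,μ,h) − e_src(t'',U,μ,h)| ≤ 4|t' − t''|`**;
  window transport `…_ge_of_ge_tp` (a floor moves at slope `4`), `…_le_of_le_tp` (a ceiling too).
* §3 ABSENT BOX CELLS IN `(t', U, μ)`. `secant_dWaveSourceEnergyDensityTT'_sub_tp_le`: the secant numerator
  `e_src(·,h₀) − e_src(·,h)` moves by at most `8|t'' − t'|` (no monotonicity in `t'`, so both terms pay);
  **`dWaveOrderParameterTT'_le_of_windows_couplings3`**: ONE certified pair `e_src(t',U,μ,0) ≤ hi₀`,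
  `lo ≤ e_src(t',U,μ,h)` (`h > 0`) gives, for ALL `(t'', U', μ')`,
  `m⋆(t'',U',μ') ≤ (hi₀ − lo + 8|t'' − t'| + |U' − U| + 2|μ' − μ|)/(2h)`; `…_tp_box`
  (`|t'' − t'| ≤ r ⇒ m⋆(t'',U,μ) ≤ (hi₀ − lo + 8r)/(2h)`); `dWaveOrderParameterTT'_lt_of_windows_near3`
  (ABSENT(`< m₀`) on the explicit box `8|Δt'| + |ΔU| + 2|Δμ| < 2h·m₀ − (hi₀ − lo)`).

HONEST SCOPE: the constant `4` is the operator-norm (kinematic) constant; at the cuprate anchors the actual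
diagonal-hopping energy is an order of magnitude smaller, and a certified two-sided `K₂` row at the anchor
would replace `8|Δt'|` by `(A − B)|Δt'|` exactly as in the unsourced layer (`HubbardTTPrimeDiagHopTransport`
§6) — not done here. Ceiling-side bookkeeping only; nothing here floors `d`-wave order.

## References
* R. B. Israel, *Convexity in the Theory of Lattice Gases* (1979), Thm. I.3.4 (the thermodynamic functional
  is `1`-Lipschitz in the interaction norm; tangent functionals at a minimiser). [cite: Israel1979, Thm. I.3.4]
* O. Bratteli, D. W. Robinson, *Operator Algebras and Quantum Statistical Mechanics I* (1987), Prop. 2.3.11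
  (states are norm-continuous with norm one). [cite: BratteliRobinsonI1987, Prop. 2.3.11]
* O. Bratteli, A. Kishimoto, D. W. Robinson, Commun. Math. Phys. 64 (1978) 41, Thm. 2 (translation-invariant
  ground states minimise the mean energy). [cite: BratteliKishimotoRobinson1978, Thm. 2]
* T. Koma, H. Tasaki, J. Stat. Phys. 76 (1994) 745–803, §1. [cite: KomaTasaki1994, §1]
-/

noncomputable section

namespace Literature.MathematicalPhysics.QuantumLattice

open _root_.Matrix Finset Set Literature.Probability.LatticeModels HubbardWave0 _root_.Filter
open scoped _root_.Topology

/-! ### §1 The a-priori diagonal-hopping row `|K₂(ω)| ≤ 4` -/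

/-- The mean-energy observable of the unit diagonal-hopping interaction `Φ(0,1,0)` (range `1`) IS that of
`diagHoppingFermionInteraction 1`: the nearest-neighbour part at `(t, U) = (0, 0)` vanishes termwise.
[cite: BratteliKishimotoRobinson1978, Thm. 2] -/
theorem meanEnergyObs_hubbardTTPrime_zero_one_zero :
    (hubbardTTPrimeFermionInteraction 0 1 0).meanEnergyObs 1 = (diagHoppingFermionInteraction 1).meanEnergyObs 1 := by
  have hnn : (hubbardFermionInteraction 2 0 0).meanEnergyObs 1 = 0 := by
    have h : ∀ X, (hubbardFermionInteraction 2 0 0).Φ X = (0 : ℂ) • (hubbardFermionInteraction 2 1 1).Φ X := by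
      intro X
      have h1 := hubbardFermionInteraction_smul (d := 2) 0 1 1 X
      rwa [zero_mul, Complex.ofReal_zero] at h1
    rw [FermionInteraction.meanEnergyObs_of_smul h, zero_smul]
  rw [hubbardTTPrimeFermionInteraction_meanEnergyObs, hnn, zero_add]

section Norm

open scoped Matrix.Norms.L2Operator

/-- **`‖E_{Φ_diag(t')}‖ ≤ 4|t'|`**: the mean-energy observable of the diagonal hopping interaction is the sum
over the two diagonal directions of two half bonds through the origin, each bond of norm `≤ 2|t'|`.
[cite: BratteliRobinsonI1987, Prop. 2.3.11] -/
theorem norm_meanEnergyObs_diagHopping_le_four_mul (t' : ℝ) :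
    ‖(diagHoppingFermionInteraction t').meanEnergyObs 1‖ ≤ 4 * |t'| := by
  rw [diagHoppingFermionInteraction_meanEnergyObs]
  have hhalf : ‖(2 : ℂ)⁻¹‖ = 2⁻¹ := by simp
  have hterm : ∀ s : Fin 2,
      ‖(2 : ℂ)⁻¹ • fermionEmbed (PolySite.incl (pair_diagVec_subset_thicken_one s))
            ((diagHoppingFermionInteraction t').Φ {0, 0 + diagVec s}) +
          (2 : ℂ)⁻¹ • fermionEmbed (PolySite.incl (pair_neg_diagVec_subset_thicken_one s))
            ((diagHoppingFermionInteraction t').Φ {-diagVec s, -diagVec s + diagVec s})‖ ≤ 2 * |t'| := by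
    intro s
    refine (norm_add_le _ _).trans ?_
    rw [norm_smul, norm_smul, hhalf]
    have h1 := norm_fermionEmbed_diagHopping_pair_le_two_mul t' (0 : Site 2) s
      (pair_diagVec_subset_thicken_one s)
    have h2 := norm_fermionEmbed_diagHopping_pair_le_two_mul t' (-diagVec s : Site 2) s
      (pair_neg_diagVec_subset_thicken_one s)
    linarith
  calc _ ≤ ∑ s : Fin 2, ‖(2 : ℂ)⁻¹ • fermionEmbed (PolySite.incl (pair_diagVec_subset_thicken_one s))
            ((diagHoppingFermionInteraction t').Φ {0, 0 + diagVec s}) +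
          (2 : ℂ)⁻¹ • fermionEmbed (PolySite.incl (pair_neg_diagVec_subset_thicken_one s))
            ((diagHoppingFermionInteraction t').Φ {-diagVec s, -diagVec s + diagVec s})‖ :=
        norm_sum_le _ _
    _ ≤ ∑ _s : Fin 2, 2 * |t'| := Finset.sum_le_sum fun s _ => hterm s
    _ = 4 * |t'| := by rw [Finset.sum_const, Finset.card_univ, Fintype.card_fin, nsmul_eq_mul]; ring

/-- **`‖E_{Φ(0,1,0)}‖ ≤ 4`** (the unit diagonal-hopping mean-energy observable). [cite: BratteliRobinsonI1987, Prop. 2.3.11] -/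
theorem norm_meanEnergyObs_hubbardTTPrime_zero_one_zero_le_four :
    ‖(hubbardTTPrimeFermionInteraction 0 1 0).meanEnergyObs 1‖ ≤ 4 := by
  rw [meanEnergyObs_hubbardTTPrime_zero_one_zero]
  have h := norm_meanEnergyObs_diagHopping_le_four_mul 1
  rwa [abs_one, mul_one] at h

/-- **THE A-PRIORI DIAGONAL-HOPPING ROW: `|K₂(ω)| ≤ 4` for every infinite-volume state `ω` on `ℤ²`**,
`K₂(ω) = e_{Φ(0,1,0)}(ω)` the unit diagonal-hopping energy per site — states are contractive. No translation
invariance and no density hypothesis. [cite: BratteliRobinsonI1987, Prop. 2.3.11] -/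
theorem InfVolFermionState.abs_meanEnergy_diagHop_le_four (ω : InfVolFermionState 2) :
    |ω.meanEnergy (hubbardTTPrimeFermionInteraction 0 1 0) 1| ≤ 4 :=
  (ω.abs_meanEnergy_le_norm _ _).trans norm_meanEnergyObs_hubbardTTPrime_zero_one_zero_le_four

end Norm

/-! ### §2 The tangent in `t'` at a minimiser and the `4`-Lipschitz law -/

section Tangent

variable (U μ h : ℝ)

/-- **Tangent inequality in `t'` at a minimiser**: if the translation-invariant state `ω` attains the sourced
energy density at `(t',U,μ,h)`, `Re ω(E^src(t',U,μ,h)) = e_src(t',U,μ,h)`, then for every `t''`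
`e_src(t'',U,μ,h) ≤ e_src(t',U,μ,h) + (t'' − t')·K₂(ω)` — the variational principle at `t''` for the same
`ω`, whose sourced mean energy is affine in `t'` with slope `K₂(ω)`. [cite: Israel1979, Thm. I.3.4] -/
theorem dWaveSourceEnergyDensityTT'_le_add_mul_diagHop_of_minimiser {t' : ℝ} {ω : InfVolFermionState 2}
    (hω : ω.IsTranslationInvariant)
    (hωe : (ω.expect dWaveSourceWindow (dWaveSourceEnergyObsTT' t' U μ h)).re = dWaveSourceEnergyDensityTT' t' U μ h)
    (t'' : ℝ) :
    dWaveSourceEnergyDensityTT' t'' U μ h ≤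
      dWaveSourceEnergyDensityTT' t' U μ h + (t'' - t') * ω.meanEnergy (hubbardTTPrimeFermionInteraction 0 1 0) 1 := by
  have hvar := dWaveSourceEnergyDensityTT'_le_re_expect t'' U μ h ω hω
  rw [ω.re_expect_dWaveSourceEnergyObsTT' t'' U μ h, InfVolFermionState.meanEnergy_hubbardTTPrimeSourced,
    ω.meanEnergy_hubbardTTPrime_affine 1 t' U t'' U, sub_self, zero_mul, add_zero] at hvar
  rw [ω.re_expect_dWaveSourceEnergyObsTT' t' U μ h, InfVolFermionState.meanEnergy_hubbardTTPrimeSourced] at hωe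
  linarith

/-- **One-sided Lipschitz step in `t'`**: `e_src(t'',U,μ,h) ≤ e_src(t',U,μ,h) + 4|t'' − t'|` (the tangent at a
minimiser, which exists, and `|K₂| ≤ 4`). [cite: Israel1979, Thm. I.3.4] -/
theorem dWaveSourceEnergyDensityTT'_le_add_four_mul_abs_sub_tp (t' t'' : ℝ) :
    dWaveSourceEnergyDensityTT' t'' U μ h ≤ dWaveSourceEnergyDensityTT' t' U μ h + 4 * |t'' - t'| := by
  obtain ⟨ω, hω, hωe⟩ := exists_re_expect_eq_dWaveSourceEnergyDensityTT' t' U μ h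
  have h1 := dWaveSourceEnergyDensityTT'_le_add_mul_diagHop_of_minimiser U μ h hω hωe t''
  have h2 := ω.abs_meanEnergy_diagHop_le_four
  have h3 : (t'' - t') * ω.meanEnergy (hubbardTTPrimeFermionInteraction 0 1 0) 1 ≤ 4 * |t'' - t'| := by
    have h4 : (t'' - t') * ω.meanEnergy (hubbardTTPrimeFermionInteraction 0 1 0) 1 ≤
        |t'' - t'| * |ω.meanEnergy (hubbardTTPrimeFermionInteraction 0 1 0) 1| := by
      rw [← abs_mul]
      exact le_abs_self _
    nlinarith [abs_nonneg (t'' - t')]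
  linarith

/-- **`e_src` is `4`-Lipschitz in `t'`**: `|e_src(t',U,μ,h) − e_src(t'',U,μ,h)| ≤ 4|t' − t''|`, all real
`t', t'', U, μ, h`. [cite: Israel1979, Thm. I.3.4] -/
theorem abs_dWaveSourceEnergyDensityTT'_sub_tp_le (t' t'' : ℝ) :
    |dWaveSourceEnergyDensityTT' t' U μ h - dWaveSourceEnergyDensityTT' t'' U μ h| ≤ 4 * |t' - t''| := by
  have h1 := dWaveSourceEnergyDensityTT'_le_add_four_mul_abs_sub_tp U μ h t' t''
  have h2 := dWaveSourceEnergyDensityTT'_le_add_four_mul_abs_sub_tp U μ h t'' t'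
  rw [abs_sub_comm t'' t'] at h1
  rw [abs_le]
  constructor <;> linarith

/-- **Window transport, FLOOR along `t'`**: `lo ≤ e_src(t') ⇒ lo − 4|t'' − t'| ≤ e_src(t'')`.
[cite: Israel1979, Thm. I.3.4] -/
theorem dWaveSourceEnergyDensityTT'_ge_of_ge_tp {t' t'' lo : ℝ} (hlo : lo ≤ dWaveSourceEnergyDensityTT' t' U μ h) :
    lo - 4 * |t'' - t'| ≤ dWaveSourceEnergyDensityTT' t'' U μ h := by
  have h1 := dWaveSourceEnergyDensityTT'_le_add_four_mul_abs_sub_tp U μ h t'' t'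
  rw [abs_sub_comm t' t''] at h1
  linarith

/-- **Window transport, CEILING along `t'`**: `e_src(t') ≤ hi ⇒ e_src(t'') ≤ hi + 4|t'' − t'|`.
[cite: Israel1979, Thm. I.3.4] -/
theorem dWaveSourceEnergyDensityTT'_le_of_le_tp {t' t'' hi : ℝ} (hhi : dWaveSourceEnergyDensityTT' t' U μ h ≤ hi) :
    dWaveSourceEnergyDensityTT' t'' U μ h ≤ hi + 4 * |t'' - t'| := by
  have h1 := dWaveSourceEnergyDensityTT'_le_add_four_mul_abs_sub_tp U μ h t' t''
  linarith

end Tangent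

/-! ### §3 ABSENT box cells in all three couplings `(t', U, μ)` -/

section Box

/-- **The secant numerator moves by at most `8|t'' − t'|` along `t'`** (any two sources `h₀, h`; no
monotonicity in `t'`, so both energies pay the Lipschitz constant `4`). [cite: Israel1979, Thm. I.3.4] -/
theorem secant_dWaveSourceEnergyDensityTT'_sub_tp_le (U μ h₀ h t' t'' : ℝ) :
    (dWaveSourceEnergyDensityTT' t'' U μ h₀ - dWaveSourceEnergyDensityTT' t'' U μ h) -
      (dWaveSourceEnergyDensityTT' t' U μ h₀ - dWaveSourceEnergyDensityTT' t' U μ h) ≤ 8 * |t'' - t'| := by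
  have h1 := dWaveSourceEnergyDensityTT'_le_add_four_mul_abs_sub_tp U μ h₀ t' t''
  have h2 := dWaveSourceEnergyDensityTT'_le_add_four_mul_abs_sub_tp U μ h t'' t'
  rw [abs_sub_comm t' t''] at h2
  linarith

/-- **Quantitative upper semicontinuity in all three couplings**: for every `h > 0`,
`m⋆(t'',U',μ') ≤ (e_src(t',U,μ,0) − e_src(t',U,μ,h) + 8|t'' − t'| + |U' − U| + 2|μ' − μ|)/(2h)`.
[cite: KomaTasaki1994, §1] -/
theorem dWaveOrderParameterTT'_le_slope_add_of_couplings3 (t' U μ t'' U' μ' : ℝ) {h : ℝ} (hh : 0 < h) :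
    dWaveOrderParameterTT' t'' U' μ' ≤
      (dWaveSourceEnergyDensityTT' t' U μ 0 - dWaveSourceEnergyDensityTT' t' U μ h + 8 * |t'' - t'| +
        |U' - U| + 2 * |μ' - μ|) / (2 * h) := by
  have h1 := dWaveOrderParameterTT'_le_slope_add_of_couplings t'' U μ U' μ' hh
  have h2 := secant_dWaveSourceEnergyDensityTT'_sub_tp_le U μ 0 h t' t''
  refine h1.trans (div_le_div_of_nonneg_right ?_ (by positivity))
  linarith

/-- **THE BOX-CELL CEILING IN `(t', U, μ)` from one certified coupling point**: `e_src(t',U,μ,0) ≤ hi₀` and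
`lo ≤ e_src(t',U,μ,h)` (`h > 0`) at the point `(t', U, μ)` give, for ALL `(t'', U', μ')`,
`m⋆(t'',U',μ') ≤ (hi₀ − lo + 8|t'' − t'| + |U' − U| + 2|μ' − μ|)/(2h)`. (Ceiling; ABSENT side only.)
[cite: Israel1979, Thm. I.3.4] -/
theorem dWaveOrderParameterTT'_le_of_windows_couplings3 {t' U μ h hi₀ lo : ℝ} (hh : 0 < h)
    (hhi : dWaveSourceEnergyDensityTT' t' U μ 0 ≤ hi₀) (hlo : lo ≤ dWaveSourceEnergyDensityTT' t' U μ h)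
    (t'' U' μ' : ℝ) :
    dWaveOrderParameterTT' t'' U' μ' ≤ (hi₀ - lo + 8 * |t'' - t'| + |U' - U| + 2 * |μ' - μ|) / (2 * h) := by
  refine (dWaveOrderParameterTT'_le_slope_add_of_couplings3 t' U μ t'' U' μ' hh).trans ?_
  exact div_le_div_of_nonneg_right (by linarith) (by positivity)

/-- The `t'`-box form at fixed `(U, μ)`: `|t'' − t'| ≤ r ⇒ m⋆(t'',U,μ) ≤ (hi₀ − lo + 8r)/(2h)`.
[cite: Israel1979, Thm. I.3.4] -/
theorem dWaveOrderParameterTT'_le_of_windows_tp_box {t' U μ h hi₀ lo r : ℝ} (hh : 0 < h)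
    (hhi : dWaveSourceEnergyDensityTT' t' U μ 0 ≤ hi₀) (hlo : lo ≤ dWaveSourceEnergyDensityTT' t' U μ h)
    {t'' : ℝ} (hr : |t'' - t'| ≤ r) :
    dWaveOrderParameterTT' t'' U μ ≤ (hi₀ - lo + 8 * r) / (2 * h) := by
  have key := dWaveOrderParameterTT'_le_of_windows_couplings3 hh hhi hlo t'' U μ
  rw [sub_self, sub_self, abs_zero, mul_zero, add_zero, add_zero] at key
  exact key.trans (div_le_div_of_nonneg_right (by linarith) (by positivity))

/-- **An ABSENT(`< m₀`) certificate at a point is an ABSENT certificate on an explicit box in `(t', U, μ)`**: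
if `8|t'' − t'| + |U' − U| + 2|μ' − μ| < 2h·m₀ − (hi₀ − lo)` then `m⋆(t'',U',μ') < m₀`.
[cite: Israel1979, Thm. I.3.4] -/
theorem dWaveOrderParameterTT'_lt_of_windows_near3 {t' U μ h hi₀ lo m₀ : ℝ} (hh : 0 < h)
    (hhi : dWaveSourceEnergyDensityTT' t' U μ 0 ≤ hi₀) (hlo : lo ≤ dWaveSourceEnergyDensityTT' t' U μ h)
    {t'' U' μ' : ℝ} (hnear : 8 * |t'' - t'| + |U' - U| + 2 * |μ' - μ| < 2 * h * m₀ - (hi₀ - lo)) :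
    dWaveOrderParameterTT' t'' U' μ' < m₀ := by
  refine lt_of_le_of_lt (dWaveOrderParameterTT'_le_of_windows_couplings3 hh hhi hlo t'' U' μ') ?_
  rw [div_lt_iff₀ (by positivity)]
  linarith

end Box

end Literature.MathematicalPhysics.QuantumLattice
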